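import Summits.QuantumFields.YangMills.Theorems.FluctuationComparisonRegPrIntLS2BetaSmallBondGaugeToronObstruction
import Literature.MathematicalPhysics.QuantumFieldTheory.Balaban1983to89.T3ThresholdSmallness
import HarnessLib

/-!
# S2β ∕ GAP♯∘ — THE FLOORED `hsupp` SUPPLIER FROM AN N-UNIFORM SMALL-BOND GAUGE «(BG∞)»: if every small-plaquette datum admits a gauge with all
# bond arcs `≤ C·√θ + c∕N` (the conjectured SU(2) lattice-gauge theorem of UV3-NODE §114.3, numerically supported by FL-39-LITE ∕ FL-39), then for every
# GAUGE-INVARIANT class `G` the HEIGHT-FLOORED supplier letter `hsupp^{≥J₀}(G, G ∧ G_{s₀})` of ✓`…StratumBodyGaugeWLOGFloor.gapStratum_of_goodGauge_floor` holds —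
# the floor `J₀(F, γ, s₀, C, c)` is where Bałaban's threshold `θBal(J)` and the torus size `N_J = 2L^{F.m+J}` make `C√θBal(J) + c∕N_J ≤ s₀`

Cell `ym3-torus` (YM ladder rung R3 = continuum `SU(2)` Yang–Mills on the three-torus — a RUNG: NOT d = 4, NOT infinite volume, NOT a mass gap, NOT Clay).
LEAD-20520 `ym-ust-20520-w3` (gen 29), DECIDING seat; explicit-unit helper on the crux `stmt-QuantumFields-20520` (`--supports`, count-neutral).  DEFINITION-FREE.

WHAT.  After tonight's three kernel `¬` (✓`not_hsupp_irrStratum`, ✓`not_hsupp_abelianStratum`, ✓p837683 `arcLetter4_abelianStratum_false`) the guarded-strata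
road reaches GAP♯∘ only above a HEIGHT FLOOR (planner RULING №120, (P5)); above the floor its ONE open supplier is `hsupp^{≥J₀}` (px5 g24's floored door
✓`gapStratum_of_goodGauge_floor`, whose `hsupp` binder this file concludes VERBATIM at `G′ := fun F J V => G F J V ∧ ∀ e, ‖logVec (su2Quat (V e))‖ ≤ s₀`).
THIS FILE: ★★★ `hsupp_floor_of_sqrtGauge (G) (hGinv) (hs₀) (hC) (hBG)` — from (i) gauge invariance of the class `G`, (ii) the «(BG∞)» HYPOTHESIS
`hBG : ∀ F J θ > 0, ∀ V, PlaqSmall θ V → ∃ u, ∀ e, arc((u • V) e) ≤ C·√θ + c ∕ N_J` (`N_J := (F.P J).sitesPerDir 0`), the floored supplier letter follows, with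
`c₀ := 1`, `pS := 0`, `γ₁ := 1` and `J₀ := max J₁ (J₂ + 1)` where `θBal F.L γ (cw·b₀) p₀ J < (s₀ ∕ (2(C+1)))²` for `J ≥ J₁` (lit ✓`T3ThresholdSmallness.tendsto_θBal_atTop`)
and `J₂ > 2c ∕ s₀` (`N_J ≥ J + 1` by `Nat.lt_pow_self`).  So, BY KERNEL: the (BG∞) road's supplier debt is EXACTLY the one conjectured theorem `hBG` (plus the
two one-line gauge-invariance facts for `G_IRR`, `G_A′`); nothing else stands between (BG∞) and the floored door.

HONEST FRAMING.  Bookkeeping over a HYPOTHESIS: `hBG` is a CONJECTURE (UV3-NODE §114.3 (iii); FL-39-LITE ∕ FL-39 numerics GUIDANCE only: SU(2) Landau-gauge max bond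
≈ (0.9–1.1)·√θ N-uniformly, 2–5× below the abelian Stokes floor) — NOT a Literature fact, NOT filed as one, NOT proved here; nothing of Bałaban's renormalisation-group
analysis is asserted or proved ([Balaban1985RegularSpaces] Lemma 1 ∕ Thm 2 gauge-fix CUBES, never a torus).  GAP♯∘ (registry v11 3732b7df UNTOUCHED; floored edition
v12.1 SIGNED, not written), the five registered stubs (0∕5), S2β, 20520, 19936, 19200, `YM3TorusSU2` NOT proved; rung R3 = SU(2) YM₃ on T³ — NOT d = 4, NOT infinite
volume, NOT a mass gap, NOT Clay.  Sorry-free; axioms {propext, Classical.choice, Quot.sound}; default heartbeats.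
-/

set_option autoImplicit false

noncomputable section

namespace Summit.QuantumFields.YangMills.Theorems.FluctuationComparisonRegPrIntLS2BetaFlooredSupplierOfSqrtGauge

open scoped Real
open Filter Topology
open Literature.MathematicalPhysics.QuantumLattice (su2Quat)
open Literature.MathematicalPhysics.QuantumFieldTheory.Balaban1983to89
open T4ExpWindowSmallField (logVec)
open T3ContinuumYM3Torus (T3Family)
open T3UnitScaleTilt (θBal)
open T3MinimiserStabilityReduction (θBal_pos)
open T3ThresholdSmallness (tendsto_θBal_atTop)

/-- The datum lattice of run `J` has `N_J = 2·L^{F.m+J}` sites per direction. [cite: Balaban1985UV3, (1)-(3) p.256] -/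
theorem sitesPerDir_run (F : T3Family) (J : ℕ) : (F.P J).sitesPerDir 0 = 2 * F.L ^ (F.m + J) := by
  show 2 * F.L ^ (F.m + J - 0) = 2 * F.L ^ (F.m + J)
  rw [Nat.sub_zero]

/-- `N_J ≥ J + 1`. [folklore] -/
theorem succ_le_sitesPerDir_run (F : T3Family) (J : ℕ) : J + 1 ≤ (F.P J).sitesPerDir 0 := by
  rw [sitesPerDir_run]
  have hL : 1 < F.L := F.hL.2
  have h1 : F.m + J < F.L ^ (F.m + J) := Nat.lt_pow_self hL
  have hm : 1 ≤ F.m := F.hm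
  calc J + 1 ≤ F.m + J := by omega
    _ ≤ F.L ^ (F.m + J) := h1.le
    _ ≤ 2 * F.L ^ (F.m + J) := by omega

/-- ★★★ **THE FLOORED SUPPLIER LETTER FROM «(BG∞)»**: for a gauge-invariant class `G` and the conjectured N-uniform small-bond gauge `arc ≤ C√θ + c∕N_J`, the
`hsupp` binder of ✓`gapStratum_of_goodGauge_floor` at `G′ := G ∧ (∀ e, arc ≤ s₀)` — with the floor `J₀` exhibited from `θBal → 0` and `N_J ≥ J + 1`.
[cite: Balaban1985UV3, (3) p.256 and (7) p.257] -/
theorem hsupp_floor_of_sqrtGauge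
    (G : (F : T3Family) → (J : ℕ) → GaugeField (F.P J) 0 (Matrix.specialUnitaryGroup (Fin 2) ℂ) → Prop)
    (hGinv : ∀ (F : T3Family) (J : ℕ) (u : GaugeTransf (F.P J) 0 (Matrix.specialUnitaryGroup (Fin 2) ℂ))
      (V : GaugeField (F.P J) 0 (Matrix.specialUnitaryGroup (Fin 2) ℂ)), G F J V → G F J (GaugeField.gaugeAct u V))
    {s₀ C c : ℝ} (hs₀ : 0 < s₀) (hC : 0 ≤ C)
    (hBG : ∀ (F : T3Family) (J : ℕ) (θ : ℝ), 0 < θ → ∀ V : GaugeField (F.P J) 0 (Matrix.specialUnitaryGroup (Fin 2) ℂ), PlaqSmall θ V →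
      ∃ u : GaugeTransf (F.P J) 0 (Matrix.specialUnitaryGroup (Fin 2) ℂ),
        ∀ e, ‖logVec (su2Quat (GaugeField.gaugeAct u V e))‖ ≤ C * Real.sqrt θ + c / (((F.P J).sitesPerDir 0 : ℕ) : ℝ)) :
    ∀ (L : ℕ), ∃ c₀ : ℝ, 0 < c₀ ∧ c₀ ≤ 1 ∧ ∀ (cw : ℝ), 0 < cw → cw ≤ c₀ → ∃ pS : ℝ, ∀ (b₀ p₀ : ℝ), 0 < b₀ → pS ≤ p₀ → 0 < p₀ →
      ∃ γ₁ : ℝ, 0 < γ₁ ∧ ∀ (F : T3Family) (γ : ℝ), F.L = L → 0 < γ → γ ≤ γ₁ → ∃ J₀ : ℕ,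
        ∀ (J : ℕ) (hJ₀ : J₀ ≤ J) (V : GaugeField (F.P J) 0 (Matrix.specialUnitaryGroup (Fin 2) ℂ)), PlaqSmall (θBal F.L γ (cw * b₀) p₀ J) V → G F J V →
          ∃ u : GaugeTransf (F.P J) 0 (Matrix.specialUnitaryGroup (Fin 2) ℂ),
            G F J (GaugeField.gaugeAct u V) ∧ ∀ e, ‖logVec (su2Quat (GaugeField.gaugeAct u V e))‖ ≤ s₀ := by
  intro L
  refine ⟨1, one_pos, le_rfl, fun cw hcw _ => ⟨0, fun b₀ p₀ hb _ _ => ⟨1, one_pos, fun F γ _ hγ hγ1 => ?_⟩⟩⟩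
  have hL1 : 1 < F.L := F.hL.2
  -- the thresholds are eventually below `(s₀ ∕ (2(C+1)))²`
  have hε : 0 < (s₀ / (2 * (C + 1))) ^ 2 := by positivity
  obtain ⟨J₁, hJ₁⟩ := eventually_atTop.1 ((tendsto_θBal_atTop hL1 hγ (cw * b₀) p₀).eventually_lt_const hε)
  -- the tori are eventually larger than `2c ∕ s₀`
  obtain ⟨J₂, hJ₂⟩ := exists_nat_gt (2 * c / s₀)
  refine ⟨max J₁ (J₂ + 1), fun J hJ V hV hGV => ?_⟩
  have hJ1 : J₁ ≤ J := (le_max_left _ _).trans hJ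
  have hJ2 : J₂ + 1 ≤ J := (le_max_right _ _).trans hJ
  have hθpos : 0 < θBal F.L γ (cw * b₀) p₀ J := θBal_pos hL1.le hγ hγ1 (mul_pos hcw hb) p₀ J
  obtain ⟨u, hu⟩ := hBG F J _ hθpos V hV
  refine ⟨u, hGinv F J u V hGV, fun e => (hu e).trans ?_⟩
  -- `C·√θ ≤ s₀ ∕ 2`
  have hθlt : θBal F.L γ (cw * b₀) p₀ J < (s₀ / (2 * (C + 1))) ^ 2 := hJ₁ J hJ1
  have hsq : Real.sqrt (θBal F.L γ (cw * b₀) p₀ J) < s₀ / (2 * (C + 1)) := by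
    calc Real.sqrt (θBal F.L γ (cw * b₀) p₀ J) < Real.sqrt ((s₀ / (2 * (C + 1))) ^ 2) :=
          Real.sqrt_lt_sqrt hθpos.le hθlt
      _ = s₀ / (2 * (C + 1)) := Real.sqrt_sq (by positivity)
  have h1 : C * Real.sqrt (θBal F.L γ (cw * b₀) p₀ J) ≤ s₀ / 2 := by
    have hsq0 : 0 ≤ Real.sqrt (θBal F.L γ (cw * b₀) p₀ J) := Real.sqrt_nonneg _
    have hC1 : 0 < C + 1 := by linarith
    calc C * Real.sqrt (θBal F.L γ (cw * b₀) p₀ J) ≤ (C + 1) * Real.sqrt (θBal F.L γ (cw * b₀) p₀ J) := by nlinarith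
      _ ≤ (C + 1) * (s₀ / (2 * (C + 1))) := by exact mul_le_mul_of_nonneg_left hsq.le hC1.le
      _ = s₀ / 2 := by field_simp
  -- `c ∕ N_J ≤ s₀ ∕ 2`
  have hN : (J : ℝ) + 1 ≤ (((F.P J).sitesPerDir 0 : ℕ) : ℝ) := by exact_mod_cast succ_le_sitesPerDir_run F J
  have hNpos : 0 < (((F.P J).sitesPerDir 0 : ℕ) : ℝ) := by linarith [(Nat.cast_nonneg J : (0 : ℝ) ≤ J)]
  have hJ2' : 2 * c / s₀ < (J : ℝ) := by
    have : ((J₂ : ℕ) : ℝ) + 1 ≤ (J : ℝ) := by exact_mod_cast hJ2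
    linarith
  have h2 : c / (((F.P J).sitesPerDir 0 : ℕ) : ℝ) ≤ s₀ / 2 := by
    rw [div_le_iff₀ hNpos]
    have h3 : 2 * c < s₀ * (J : ℝ) := by
      have := (div_lt_iff₀ hs₀).1 hJ2'
      linarith
    nlinarith
  linarith

end Summit.QuantumFields.YangMills.Theorems.FluctuationComparisonRegPrIntLS2BetaFlooredSupplierOfSqrtGauge

end
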